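import Summits.Ventures.PercRepro.ProfilePointedTriangle

/-!
# PercRepro — THE COLOOP LIMIT AT A TRIANGLE, II: THE MAP `σ` AND THE IDENTITY
`Φ(M, p) − #𝒦(M ／ e, p) = 2 · Σ_{X ∈ F₁} (2 #X − N) + Σ_{X ∈ F₂} (2 #X − N)`
(p10, gen 17; `proofs/P10-AVFULL.md` §25(l))

For a triangle `{p, e, b}` through `p` (`IsTriangle`, ProfilePointedTriangle) and the families `F₁`, `P₁′`, `F₂` and the
map `τ` of that module: `σ : X ↦ (X ∖ b) ∪ e` is a size-preserving bijection from `F₁ = {X ∈ 𝒦 : e ∉ X, p ∈ cl (X ∖ b)}`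
onto the sets of `restPart e` avoiding `b` (`sigma_mem`, `sigma_inv_mem`, `sum_restPart_notMem_eq_sum_triF1`); with the
`τ`-part (`sum_restPart_mem_eq_neg_sum`), the contraction split (`sum_capSets_signed_eq_contract_split`) and the
parallel-pair theorem for `M ／ e` (where `p ∥ b`, so `Φ(M ／ e, p) = 0`, `sum_contract_eq_zero`) this gives THE
IDENTITY (`sum_capSets_signed_triangle`)

  `Φ(M, p) = #𝒦(M ／ e, p) + 2 · Σ_{X ∈ F₁} (2 #X − N) + Σ_{X ∈ F₂} (2 #X − N)`.

So the conjecture (TRI) «`Φ(M, p) ≥ #𝒦(M ／ e, p)`» (`TriangleStep`, 100th module) is, at each triangle, the inequality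
`2 · Σ_{F₁} (2 #X − N) + Σ_{F₂} (2 #X − N) ≥ 0` (`triangleStep_iff_weighted`) — a statement about the `e`-avoiding
captured sets alone; on every triangle instance with ≤ 8 elements both sums are ≥ 0 separately (census, not
asserted).  Nothing here asserts (TRI) or (C1′).
-/

open scoped Matroid

namespace PercRepro.Cogirth

open Finset ThmH Skew

variable {α : Type} [DecidableEq α] {M : Matroid α} [M.Finite] {p e b : α}

/-! ### The map `σ` -/

/-- `σ X = (X ∖ b) ∪ e`. -/
noncomputable def sigma (e b : α) (X : Finset α) : Finset α := insert e (X.erase b)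

/-- **`σ` MAPS `F₁` INTO `restPart e ∩ {b ∉ Z}`**. -/
theorem IsTriangle.sigma_mem (hT : IsTriangle M p e b) {X : Finset α} (hX : X ∈ triF1 M p e b) :
    sigma e b X ∈ restPart M p e ∧ b ∉ sigma e b X := by
  unfold triF1 at hX
  rw [mem_filter] at hX
  obtain ⟨hXK, heX, hpcl⟩ := hX
  have hbX : b ∈ X := (hT.mem_or_mem hXK).resolve_left heX
  obtain ⟨⟨hXb, hpX⟩, -⟩ := mem_capSets.1 hXK
  obtain ⟨hXg, hXr, hXc⟩ := mem_biIndepAll.1 hXb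
  have hXbg : X.erase b ⊆ gr M := (erase_subset _ _).trans hXg
  have hXbr : rk M (X.erase b) = (X.erase b).card := rk_eq_card_of_subset_of_rk_eq_card (erase_subset _ _) hXr
  have heXb : e ∉ X.erase b := fun h => heX (mem_of_mem_erase h)
  have hpXb : p ∉ X.erase b := fun h => hpX (mem_of_mem_erase h)
  -- `e ∉ cl (X ∖ b)`: otherwise `b ∈ cl (X ∖ b)`
  have hecl : e ∉ clF M (X.erase b) := fun he =>
    notMem_clF_erase_of_rk_eq_card hT.hb hXg hXr hbX (hT.b_mem_clF_of hXbg hpcl he)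
  have hrS : rk M (sigma e b X) = (sigma e b X).card :=
    rk_insert_eq_card_of_notMem_clF hT.he hXbg hXbr heXb hecl
  -- the complement `(W ∪ b)` with `W = (E ∖ X) ∖ e ∋ p`
  set W := (gr M \ X).erase e with hWdef
  have hWg : W ⊆ gr M := (erase_subset _ _).trans sdiff_subset
  have hpW : p ∈ W := mem_erase.2 ⟨hT.hpe, mem_sdiff.2 ⟨hT.hp, hpX⟩⟩
  have hbW : b ∉ W := fun h => (mem_sdiff.1 (mem_of_mem_erase h)).2 hbX
  have heW : e ∉ W := notMem_erase e _
  have heZ : e ∈ gr M \ X := mem_sdiff.2 ⟨hT.he, heX⟩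
  have hW : insert e W = gr M \ X := insert_erase heZ
  have hWr : rk M W = W.card := rk_eq_card_of_subset_of_rk_eq_card (erase_subset _ _) hXc
  have heWcl : e ∉ clF M W := by
    apply notMem_clF_of_rk_insert hT.he hWg heW
    rw [hW]
    exact hXc
  have hbWcl : b ∉ clF M W := fun hb =>
    heWcl (hT.e_mem_clF_of hWg (subset_clF_self_of_subset_gr hWg hpW) hb)
  have hrW : rk M (insert b W) = (insert b W).card := rk_insert_eq_card_of_notMem_clF hT.hb hWg hWr hbW hbWcl
  have hcomp : gr M \ sigma e b X = insert b W := by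
    unfold sigma
    rw [sdiff_insert, sdiff_erase hT.hb, hWdef, erase_insert_of_ne hT.heb.symm]
  have hpS : p ∈ clF M (sigma e b X) := clF_mono_sub (subset_insert e _) hpcl
  have hbS : b ∉ sigma e b X := by
    unfold sigma
    rw [mem_insert, not_or]
    exact ⟨hT.heb.symm, notMem_erase b X⟩
  refine ⟨?_, hbS⟩
  unfold restPart
  rw [mem_filter, mem_capSets, mem_biIndepAll]
  refine ⟨⟨⟨⟨?_, hrS, ?_⟩, ?_⟩, hpS⟩, mem_insert_self _ _, ?_, ?_⟩
  · unfold sigma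
    exact insert_subset hT.he hXbg
  · rw [hcomp]
    exact hrW
  · unfold sigma
    rw [mem_insert, not_or]
    exact ⟨hT.hpe, hpXb⟩
  · rw [hcomp]
    exact hT.e_mem_clF_of (insert_subset hT.hb hWg)
      (subset_clF_self_of_subset_gr (insert_subset hT.hb hWg) (mem_insert_of_mem hpW))
      (subset_clF_self_of_subset_gr (insert_subset hT.hb hWg) (mem_insert_self _ _))
  · intro h
    apply h.2
    unfold sigma
    rw [erase_insert heXb]
    exact hpcl

/-- **THE INVERSE OF `σ`**: for `Z ∈ restPart e` with `b ∉ Z`, `(Z ∖ e) ∪ b ∈ F₁`. -/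
theorem IsTriangle.sigma_inv_mem (hT : IsTriangle M p e b) {Z : Finset α} (hZ : Z ∈ restPart M p e)
    (hbZ : b ∉ Z) : sigma b e Z ∈ triF1 M p e b := by
  unfold restPart at hZ
  rw [mem_filter] at hZ
  obtain ⟨hZK, heZ, hecl, hrest⟩ := hZ
  obtain ⟨⟨hZb, hpZ⟩, hpcl⟩ := mem_capSets.1 hZK
  obtain ⟨hZg, hZr, hZc⟩ := mem_biIndepAll.1 hZb
  have hZeg : Z.erase e ⊆ gr M := (erase_subset _ _).trans hZg
  have hZer : rk M (Z.erase e) = (Z.erase e).card := rk_eq_card_of_subset_of_rk_eq_card (erase_subset _ _) hZr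
  have hbZe : b ∉ Z.erase e := fun h => hbZ (mem_of_mem_erase h)
  have hpZe : p ∉ Z.erase e := fun h => hpZ (mem_of_mem_erase h)
  -- the rest condition must be `p ∈ cl (Z ∖ e)`: `e ∈ cl Y` is impossible since `b ∈ Y`
  set Y := (gr M \ Z).erase p with hYdef
  have hYg : Y ⊆ gr M := (erase_subset _ _).trans sdiff_subset
  have hbY : b ∈ Y := mem_erase.2 ⟨hT.hpb.symm, mem_sdiff.2 ⟨hT.hb, hbZ⟩⟩
  have hpY : p ∉ Y := notMem_erase p _
  have hY : insert p Y = gr M \ Z := insert_erase (mem_sdiff.2 ⟨hT.hp, hpZ⟩)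
  have hpYcl : p ∉ clF M Y := by
    apply notMem_clF_of_rk_insert hT.hp hYg hpY
    rw [hY]
    exact hZc
  have hpZecl : p ∈ clF M (Z.erase e) := by
    by_contra hp'
    apply hrest
    refine ⟨?_, hp'⟩
    intro heY
    exact hpYcl (hT.p_mem_clF_of hYg heY (subset_clF_self_of_subset_gr hYg hbY))
  -- `b ∉ cl (Z ∖ e)`: otherwise `e ∈ cl (Z ∖ e)`
  have hbcl : b ∉ clF M (Z.erase e) := fun hb =>
    notMem_clF_erase_of_rk_eq_card hT.he hZg hZr heZ (hT.e_mem_clF_of hZeg hpZecl hb)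
  have hrS : rk M (sigma b e Z) = (sigma b e Z).card :=
    rk_insert_eq_card_of_notMem_clF hT.hb hZeg hZer hbZe hbcl
  -- the complement `(W ∪ e)` with `W = (E ∖ Z) ∖ b ∋ p`
  set W := (gr M \ Z).erase b with hWdef
  have hWg : W ⊆ gr M := (erase_subset _ _).trans sdiff_subset
  have hpW : p ∈ W := mem_erase.2 ⟨hT.hpb, mem_sdiff.2 ⟨hT.hp, hpZ⟩⟩
  have heW : e ∉ W := fun h => (mem_sdiff.1 (mem_of_mem_erase h)).2 heZ
  have hbW : b ∉ W := notMem_erase b _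
  have hbZ' : b ∈ gr M \ Z := mem_sdiff.2 ⟨hT.hb, hbZ⟩
  have hW : insert b W = gr M \ Z := insert_erase hbZ'
  have hWr : rk M W = W.card := rk_eq_card_of_subset_of_rk_eq_card (erase_subset _ _) hZc
  have hbWcl : b ∉ clF M W := by
    apply notMem_clF_of_rk_insert hT.hb hWg hbW
    rw [hW]
    exact hZc
  have heWcl : e ∉ clF M W := fun he =>
    hbWcl (hT.b_mem_clF_of hWg (subset_clF_self_of_subset_gr hWg hpW) he)
  have hrW : rk M (insert e W) = (insert e W).card := rk_insert_eq_card_of_notMem_clF hT.he hWg hWr heW heWcl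
  have hcomp : gr M \ sigma b e Z = insert e W := by
    unfold sigma
    rw [sdiff_insert, sdiff_erase hT.he, hWdef, erase_insert_of_ne hT.heb]
  unfold triF1
  rw [mem_filter, mem_capSets, mem_biIndepAll]
  refine ⟨⟨⟨⟨?_, hrS, ?_⟩, ?_⟩, ?_⟩, ?_, ?_⟩
  · unfold sigma
    exact insert_subset hT.hb hZeg
  · rw [hcomp]
    exact hrW
  · unfold sigma
    rw [mem_insert, not_or]
    exact ⟨hT.hpb, hpZe⟩
  · unfold sigma
    exact clF_mono_sub (subset_insert b _) hpZecl
  · unfold sigma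
    rw [mem_insert, not_or]
    exact ⟨hT.heb, notMem_erase e Z⟩
  · unfold sigma
    rw [erase_insert hbZe]
    exact hpZecl

/-- **THE `σ`-PART OF `restPart e`**: `Σ_{Z ∈ restPart e, b ∉ Z} (2 #Z − N) = Σ_{X ∈ F₁} (2 #X − N)`. -/
theorem IsTriangle.sum_restPart_notMem_eq_sum_triF1 (hT : IsTriangle M p e b) :
    ∑ Z ∈ (restPart M p e).filter (fun Z => b ∉ Z), (2 * (Z.card : ℤ) - (gr M).card) =
      ∑ X ∈ triF1 M p e b, (2 * (X.card : ℤ) - (gr M).card) := by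
  symm
  apply sum_nbij' (fun X => sigma e b X) (fun Z => sigma b e Z)
  · intro X hX
    rw [mem_filter]
    exact hT.sigma_mem hX
  · intro Z hZ
    rw [mem_filter] at hZ
    exact hT.sigma_inv_mem hZ.1 hZ.2
  · intro X hX
    unfold triF1 at hX
    rw [mem_filter] at hX
    obtain ⟨hXK, heX, -⟩ := hX
    have hbX : b ∈ X := (hT.mem_or_mem hXK).resolve_left heX
    unfold sigma
    rw [erase_insert (fun h => heX (mem_of_mem_erase h)), insert_erase hbX]
  · intro Z hZ
    rw [mem_filter] at hZ
    have heZ : e ∈ Z := (mem_filter.1 hZ.1).2.1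
    unfold sigma
    rw [erase_insert (fun h => hZ.2 (mem_of_mem_erase h)), insert_erase heZ]
  · intro X hX
    unfold triF1 at hX
    rw [mem_filter] at hX
    obtain ⟨hXK, heX, -⟩ := hX
    have hbX : b ∈ X := (hT.mem_or_mem hXK).resolve_left heX
    unfold sigma
    rw [card_insert_of_notMem (fun h => heX (mem_of_mem_erase h)), card_erase_of_mem hbX]
    have := card_pos.2 ⟨b, hbX⟩
    have h1 : ((X.card - 1 + 1 : ℕ) : ℤ) = X.card := by
      rw [Nat.sub_add_cancel this]
    rw [h1]

/-! ### The identity -/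

/-- `Φ(M ／ e, p) = 0` at a triangle: `p ∥ b` in the contraction. -/
theorem IsTriangle.sum_contract_eq_zero (hT : IsTriangle M p e b) (heI : M.Indep ({e} : Set α)) :
    ∑ X' ∈ capSets (M ／ ({e} : Set α)) p, (2 * (X'.card : ℤ) - (gr (M ／ ({e} : Set α))).card) = 0 := by
  have hpe : p ∈ (gr M).erase e := mem_erase.2 ⟨hT.hpe, hT.hp⟩
  have hbe : b ∈ (gr M).erase e := mem_erase.2 ⟨hT.heb.symm, hT.hb⟩
  have h1 := rk_contract_add_one heI (singleton_subset_iff.2 hpe)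
  have h2 := rk_contract_add_one heI (singleton_subset_iff.2 hbe)
  have h3 := rk_contract_add_one heI (insert_subset hpe (singleton_subset_iff.2 hbe))
  rw [show insert e ({p} : Finset α) = {p, e} from pair_comm e p, hT.rpe] at h1
  rw [show insert e ({b} : Finset α) = {e, b} from rfl, hT.reb] at h2
  rw [show insert e ({p, b} : Finset α) = {p, e, b} from insert_comm e p {b}, hT.rpeb] at h3
  apply sum_capSets_signed_parallel (e := b)
  · rw [gr_contract']
    exact hpe
  · rw [gr_contract']
    exact hbe
  · exact hT.hpb
  · omega
  · omega
  · omega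

/-- **THE COLOOP LIMIT AT A TRIANGLE**:
`Φ(M, p) = #𝒦(M ／ e, p) + 2 · Σ_{X ∈ F₁} (2 #X − N) + Σ_{X ∈ F₂} (2 #X − N)`. -/
theorem IsTriangle.sum_capSets_signed_triangle (hT : IsTriangle M p e b) (heI : M.Indep ({e} : Set α)) :
    ∑ X ∈ capSets M p, (2 * (X.card : ℤ) - (gr M).card) =
      (capSets (M ／ ({e} : Set α)) p).card +
        2 * ∑ X ∈ triF1 M p e b, (2 * (X.card : ℤ) - (gr M).card) +
        ∑ X ∈ triF2 M p e b, (2 * (X.card : ℤ) - (gr M).card) := by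
  rw [sum_capSets_signed_eq_contract_split hT.hp heI hT.hpe, hT.sum_contract_eq_zero heI,
    sum_avoidPart_eq_triF1_add_triP1' p e b,
    ← sum_filter_add_sum_filter_not (restPart M p e) (fun Z => b ∈ Z),
    hT.sum_restPart_mem_eq_neg_sum, hT.sum_restPart_notMem_eq_sum_triF1]
  unfold triF2
  rw [← sum_filter_add_sum_filter_not (triP1' M p e b) (fun X => tau M p b X ∈ swapPart M p e)]
  ring

/-- **(TRI) AT A TRIANGLE IS THE WEIGHTED INEQUALITY** `2 · Σ_{F₁} (2 #X − N) + Σ_{F₂} (2 #X − N) ≥ 0`. -/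
theorem IsTriangle.triangleStep_iff_weighted (hT : IsTriangle M p e b) (heI : M.Indep ({e} : Set α)) :
    ((capSets (M ／ ({e} : Set α)) p).card : ℤ) ≤ ∑ X ∈ capSets M p, (2 * (X.card : ℤ) - (gr M).card) ↔
      0 ≤ 2 * ∑ X ∈ triF1 M p e b, (2 * (X.card : ℤ) - (gr M).card) +
        ∑ X ∈ triF2 M p e b, (2 * (X.card : ℤ) - (gr M).card) := by
  rw [hT.sum_capSets_signed_triangle heI]
  constructor <;> intro h <;> linarith

end PercRepro.Cogirth
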